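import Summits.Ventures.YMGap.RobustBall.BoundaryDecayTorus
import Summits.Ventures.YMGap.RobustBall.PeriodisedDLR
import Summits.Ventures.YMGap.RobustBall.TorusOneLink
import HarnessLib

/-!
# Venture YMGap, track ROBUST-BALL — ONE STATE AT A RATE, step 6: FINITE-SIZE EFFECT OF THE TORUS FOR THE PERTURBED MEMBERS —
# the periodised torus states of a member approach its infinite-volume state exponentially fast in the torus side

HONEST FRAMING. WHAT THIS IS: a venture file (cell `pub-ymgap`, track Y2 ROBUST-BALL, seat ds-3, theorems only): the quantitative
form of the VAN HOVE JOIN (`PeriodisedDLR.lean`, `OneStateLimit.lean`: «unique DLR state = full-sequence limit of the periodised torus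
states», no rate). On the torus of side `L + 1` the periodised member (`periodisedFamily W supp … L`: the member's active listed sets
based in the centred box of radius `L/2`, read through the periodic lift) satisfies the member's `ℤ^d` DLR equation in every box that
fits (`expectation_boxMember_dlr`), so its torus expectation of a lifted local observable is a torus AVERAGE of finite-volume Gibbs
expectations `γ^W_{boxLinks n}(F | η)`; each of these is within the boundary bound of every DLR state (`BoundaryDecayBox.lean`). Hence:
* `abs_expectation_boxMember_sub_le_of_forall_boundary` — a boundary-uniform bound `|∫ F dγ^W_Λ(·|η) − c| ≤ B` passes to the perturbed
  torus state of the box member once the active family of `Λ` and the collars fit in the box;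
* ★ `abs_periodised_sub_integral_le_of_isKRContraction` — ANY `IsKRContraction (perturbedYM … W supp) suFrobDist (perturbedNbr supp) C`
  with row sums `≤ ρ < 1`, member of range `R` with gauge-invariant measurable bounded continuous terms reading their own links, every
  DLR state `μ`, every Lipschitz cylinder `F` (constant `K`) on links `Δ ⊆ boxLinks d m`, `m ≤ n`, and every torus size `L` with
  `n + max(1, R) ≤ L/2`:
  `|⟨F ∘ torusLift⟩^{W}_{(ℤ/(L+1))^d} − ∫ F dμ| ≤ 2√N · K · #Δ · max(ρ,½)^{⌊(n − m)/max(1,R)⌋₊}`;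
* `SU(2)`, `d = 4`, hypothesis-free on the ball (`su2_abs_periodised_sub_integral_le_dim4`): `6|β_W| e^{ε₀} + e^{ε₀/2} √(2/3) ε₁ ≤ ρ < 1`
  ⇒ the bound with `2√2` for every member of `MemBallZd ε₀ ε₁ R` with gauge-invariant terms.
WHAT THIS IS NOT: Dobrushin-comparison lower bound on the rate, single-link doors; lattice strong coupling only, nothing about the
continuum limit or the Clay Millennium problem.

References: H.-O. Georgii (2011), Thm. 4.17 / (4.18), Remark 8.26; S. Friedli, Y. Velenik (2017), remark before Ex. 6.14; the
track's `PeriodisedDLR.lean` (`expectation_boxMember_dlr`), `PeriodisedBox.lean`, `BoundaryDecayBox.lean`.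
-/

noncomputable section

open MeasureTheory Filter Function ProbabilityTheory Real
open scoped NNReal
open Literature.Probability.LatticeModels
open Literature.Probability.LatticeModels.DobrushinMetric
open Literature.MathematicalPhysics.QuantumLattice hiding torusNorm
open Literature.MathematicalPhysics.QuantumFieldTheory hiding ZdEdge Site
open Summit.QuantumFields.BalabanUV.InfraRed.StrongCouplingPoincareDoorSUN (oneLinkPoincareSUN_two_sharp)

namespace Summit.Ventures.YMGap.RobustBall

variable {d N : ℕ}

/-! ### The perturbed torus state of a box member inherits every boundary-uniform bound -/

section Torus

variable {L : ℕ} [NeZero L] {W : Potential (ZdEdge d) (SUN N)} {supp : Finset (ZdEdge d) → Finset (Finset (ZdEdge d))}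
  (hdep : ∀ X, DependsOn (W X) (↑X : Set (ZdEdge d))) (hg : ∀ X, IsZdGaugeInvariant (W X))
  (hm : ∀ X, Measurable (W X)) (hb : ∀ X, ∃ C, ∀ U, |W X U| ≤ C)

/-- **The perturbed torus state of the box member inherits every boundary-uniform bound.** In the setting of
`expectation_boxMember_dlr` (the active family of `Λ` inside the box family of radius `n`, `2n < L`, the base sites of `Λ`, of the
support of `F` and of the collars of `Λ` in the box), if `|∫ F dγ^W_Λ(· | η) − c| ≤ B` for EVERY boundary field `η`, then
`|⟨F ∘ torusLift⟩ − c| ≤ B` under the perturbed torus state of `chartMember L (boxFamily W supp n) W`. [folklore] -/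
theorem abs_expectation_boxMember_sub_le_of_forall_boundary (hsupp : W.IsSupportedBy supp) (hWc : ∀ X, Continuous (W X))
    {n : ℕ} (hn : 2 * n < L) (β : ℝ) (Λ : Finset (ZdEdge d)) {F : LGConfig d (SUN N) → ℝ} (hF : Continuous F) {C : ℝ}
    (hC : ∀ U, |F U| ≤ C) {S₀ : Finset (ZdEdge d)} (hFS : IsCylinder F S₀)
    (hact : activeFamily W supp Λ ⊆ boxFamily W supp n)
    (hbig : (Λ ∪ (S₀ ∪ (Λ ∪ Λ.biUnion (perturbedNbr supp))) ∪ (plaquettesTouching Λ).biUnion plaquetteEdges).image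
        Prod.fst ⊆ siteBox d n)
    {c B : ℝ} (hB : ∀ η, |(∫ U, F U ∂(perturbedYM (d := d) (fundamentalRep (Fin N)) β W supp Λ η)) - c| ≤ B) :
    |(chartMember L (boxFamily W supp n) W hdep hg hm hb).expectation (fundamentalRep (Fin N)) β (toTorusObservable L F) - c|
      ≤ B := by
  classical
  haveI : SecondCountableTopology (Matrix (Fin N) (Fin N) ℂ) :=
    inferInstanceAs (SecondCountableTopology (Fin N → Fin N → ℂ))
  haveI : SecondCountableTopology (SUN N) := Topology.IsEmbedding.subtypeVal.secondCountableTopology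
  have hρ : Continuous (fundamentalRep (Fin N)) := continuous_fundamentalRep (Fin N)
  rw [expectation_boxMember_dlr hdep hg hm hb hsupp hn β Λ hF hC hFS hact hbig]
  set W' := chartMember L (boxFamily W supp n) W hdep hg hm hb with hW'
  haveI := isProbabilityMeasure_perturbedMeasure W' β
  set g : LGConfig d (SUN N) → ℝ := fun η => ∫ U, F U ∂(perturbedYM (d := d) (fundamentalRep (Fin N)) β W supp Λ η) with hgd
  have hgc : Continuous g := continuous_integral_perturbedYM _ hρ β hWc supp Λ hF hC
  haveI hγprob : ∀ η, IsProbabilityMeasure (perturbedYM (d := d) (fundamentalRep (Fin N)) β W supp Λ η) :=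
    fun η => isProbabilityMeasure_perturbedYM _ hρ β hm hb supp Λ η
  have hgb : ∀ η, |g η| ≤ C := fun η => by
    have h := norm_integral_le_of_norm_le_const (μ := perturbedYM (d := d) (fundamentalRep (Fin N)) β W supp Λ η)
      (f := F) (C := C) (ae_of_all _ fun U => by simpa [Real.norm_eq_abs] using hC U)
    simpa [Real.norm_eq_abs] using h
  have htc : Continuous (toTorusObservable L g) := hgc.comp (continuous_torusLift L)
  have hint : Integrable (toTorusObservable L g) (W'.perturbedMeasure (fundamentalRep (Fin N)) β) :=
    Integrable.of_bound htc.measurable.aestronglyMeasurable C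
      (ae_of_all _ fun V => by rw [Real.norm_eq_abs]; exact hgb _)
  unfold QuasiLocalGaugePerturbation.expectation
  have e1 : (∫ V, toTorusObservable L g V ∂(W'.perturbedMeasure (fundamentalRep (Fin N)) β)) - c =
      ∫ V, (toTorusObservable L g V - c) ∂(W'.perturbedMeasure (fundamentalRep (Fin N)) β) := by
    rw [integral_sub hint (integrable_const c), integral_const, smul_eq_mul, probReal_univ, one_mul]
  rw [e1]
  calc |∫ V, (toTorusObservable L g V - c) ∂(W'.perturbedMeasure (fundamentalRep (Fin N)) β)|
      ≤ ∫ V, |toTorusObservable L g V - c| ∂(W'.perturbedMeasure (fundamentalRep (Fin N)) β) := abs_integral_le_integral_abs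
    _ ≤ ∫ _V, B ∂(W'.perturbedMeasure (fundamentalRep (Fin N)) β) :=
        integral_mono (hint.sub (integrable_const c)).abs (integrable_const B) fun V => hB _
    _ = B := by simp

end Torus

/-! ### Geometry: a box of links, its range collar and its plaquette collar inside a bigger box -/

/-- **The collars of a box of links fit in a box `max(1, R)` larger**: for a member of `ℓ^∞`-range `R`, `Δ ⊆ boxLinks d m`, `m ≤ n`
and `n + max(1, R) ≤ n'`, the base points of `boxLinks d n`, of `Δ`, of the range collar `⋃_e perturbedNbr supp e` and of the
plaquette collar of `boxLinks d n` all lie in `siteBox d n'`. [folklore] -/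
theorem image_fst_boxCollars_subset {supp : Finset (ZdEdge d) → Finset (Finset (ZdEdge d))} {R : ℝ}
    (hR : ∀ e, ∀ X ∈ supp {e}, e ∈ X → ∀ y ∈ X, ‖e.1 - y.1‖ ≤ R) {m n n' : ℕ} (hmn : m ≤ n)
    (hn' : (n : ℝ) + max 1 R ≤ n') {Δ : Finset (ZdEdge d)} (hΔ : Δ ⊆ boxLinks d m) :
    (boxLinks d n ∪ (Δ ∪ (boxLinks d n ∪ (boxLinks d n).biUnion (perturbedNbr supp))) ∪
        (plaquettesTouching (boxLinks d n)).biUnion plaquetteEdges).image Prod.fst ⊆ siteBox d n' := by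
  classical
  have h1R : (1 : ℝ) ≤ max 1 R := le_max_left _ _
  have hmn' : (m : ℝ) ≤ n := by exact_mod_cast hmn
  intro x hx
  obtain ⟨e, he, rfl⟩ := Finset.mem_image.1 hx
  rw [mem_siteBox_iff_norm]
  have hbox : ∀ {e : ZdEdge d}, e ∈ boxLinks d n → ‖e.1‖ ≤ n := fun he => mem_siteBox_iff_norm.1 (mem_boxLinks.1 he)
  rcases Finset.mem_union.1 he with he | he
  · rcases Finset.mem_union.1 he with he | he
    · have := hbox he; linarith
    · rcases Finset.mem_union.1 he with he | he
      · have := mem_siteBox_iff_norm.1 (mem_boxLinks.1 (hΔ he)); linarith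
      · rcases Finset.mem_union.1 he with he | he
        · have := hbox he; linarith
        · obtain ⟨e₀, he₀, hee₀⟩ := Finset.mem_biUnion.1 he
          have h1 := norm_sub_le_of_mem_perturbedNbr hR e₀ hee₀
          have h2 := hbox he₀
          have h3 : ‖e.1‖ ≤ ‖e₀.1‖ + ‖e₀.1 - e.1‖ := by
            have := norm_sub_norm_le e.1 e₀.1
            rw [norm_sub_rev] at this
            linarith
          linarith
  · obtain ⟨p, hp, hep⟩ := Finset.mem_biUnion.1 he
    obtain ⟨z, hz⟩ := mem_plaquettesTouching_iff.1 hp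
    obtain ⟨hzp, hzbox⟩ := Finset.mem_inter.1 hz
    have h1 : ‖z.1 - e.1‖ ≤ 1 := norm_sub_le_one_of_mem_plaquetteEdges hzp hep
    have h2 := hbox hzbox
    have h3 : ‖e.1‖ ≤ ‖z.1‖ + ‖z.1 - e.1‖ := by
      have := norm_sub_norm_le e.1 z.1
      rw [norm_sub_rev] at this
      linarith
    linarith

/-! ### The member: the periodised torus states approach every DLR state at the boundary rate -/

/-- ★ **FINITE-SIZE EFFECT OF THE TORUS FOR A PERTURBED MEMBER, from ANY robust single-link door.** Let the member `(W, supp)` have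
gauge-invariant measurable bounded continuous terms reading their own links, support family `supp` of `ℓ^∞`-range `R`, and an
`IsKRContraction (perturbedYM (fundamentalRep (Fin N)) β W supp) suFrobDist (perturbedNbr supp) C` with row sums `≤ ρ < 1`. Then for every
DLR state `μ`, every Lipschitz cylinder `F` (constant `K`) on links `Δ ⊆ boxLinks d m`, `m ≤ n`, and every `L` with `n + max(1,R) ≤ L/2`:
`|⟨F ∘ torusLift⟩^{W,per}_{(ℤ/(L+1))^d, β} − ∫ F dμ| ≤ 2√N · K · #Δ · max(ρ,½)^{⌊(n − m)/max(1,R)⌋₊}` — the periodised torus state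
(`periodisedFamily W supp … L`) is exponentially close, in the free room `n − m`, to every infinite-volume state. [folklore] -/
theorem abs_periodised_sub_integral_le_of_isKRContraction {β ρ R : ℝ} {W : Potential (ZdEdge d) (SUN N)}
    {supp : Finset (ZdEdge d) → Finset (Finset (ZdEdge d))} (hdep : ∀ X, DependsOn (W X) (↑X : Set (ZdEdge d)))
    (hg : ∀ X, IsZdGaugeInvariant (W X)) (hm : ∀ X, Measurable (W X)) (hb : ∀ X, ∃ C, ∀ U, |W X U| ≤ C)
    (hWc : ∀ X, Continuous (W X)) (hsupp : W.IsSupportedBy supp) {C : ZdEdge d → ZdEdge d → ℝ}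
    (hKR : IsKRContraction (perturbedYM (d := d) (fundamentalRep (Fin N)) (N * β) W supp) suFrobDist
      (perturbedNbr supp) C)
    (hrow : ∀ x, ∑ y ∈ perturbedNbr supp x, C x y ≤ ρ) (hρ : ρ < 1)
    (hR : ∀ e, ∀ X ∈ supp {e}, e ∈ X → ∀ y ∈ X, ‖e.1 - y.1‖ ≤ R)
    {μ : Measure (LGConfig d (SUN N))} (hμ : μ ∈ perturbedGibbsMeasures (d := d) (fundamentalRep (Fin N)) (N * β) W supp)
    {m n L : ℕ} (hmn : m ≤ n) (hL : (n : ℝ) + max 1 R ≤ (L / 2 : ℕ))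
    {F : LGConfig d (SUN N) → ℝ} {Δ : Finset (ZdEdge d)} {K : ℝ≥0} (hF : IsLipschitzCylinder (fundamentalRep (Fin N)) F Δ K)
    (hΔ : Δ ⊆ boxLinks d m) :
    |(periodisedFamily W supp hdep hg hm hb L).expectation (fundamentalRep (Fin N)) (N * β) (toTorusObservable (L + 1) F) -
        ∫ U, F U ∂μ| ≤ 2 * Real.sqrt N * K * Δ.card * (max ρ (1 / 2)) ^ ⌊((n : ℝ) - m) / max 1 R⌋₊ := by
  haveI : NeZero (L + 1) := ⟨Nat.succ_ne_zero L⟩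
  have hW : W.IsAdapted := fun X => ⟨hdep X, hm X⟩
  have hact : activeFamily W supp (boxLinks d n) ⊆ boxFamily W supp (L / 2) :=
    activeFamily_subset_boxFamily hsupp hR fun x hx => by
      have h1 : ‖x‖ ≤ n := by
        obtain ⟨e, he, rfl⟩ := Finset.mem_image.1 hx
        exact mem_siteBox_iff_norm.1 (mem_boxLinks.1 he)
      have h2 : R ≤ max 1 R := le_max_right _ _
      linarith
  have hbig := image_fst_boxCollars_subset (supp := supp) hR hmn hL hΔ
  rw [periodisedFamily_apply]
  exact abs_expectation_boxMember_sub_le_of_forall_boundary hdep hg hm hb hsupp hWc (n := L / 2) (by omega) _ (boxLinks d n)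
    (continuous_of_isLipschitzCylinder hF) hF.abs_le hF.isCylinder hact hbig
    fun η => abs_box_sub_integral_le_of_isKRContraction hW hb hsupp hKR hrow hρ hR hμ n η hF hΔ

/-- **`SU(2)`, `d = 4`, HYPOTHESIS-FREE, UNIFORMLY ON THE BALL — finite-size effect of the torus for the members**: if
`6|β_W| e^{ε₀} + e^{ε₀/2} √(2/3) ε₁ ≤ ρ < 1` then for every member of `MemBallZd ε₀ ε₁ R` with gauge-invariant terms, every DLR state `μ`,
every Lipschitz cylinder `F` on links `Δ ⊆ boxLinks 4 m`, `m ≤ n`, `n + max(1,R) ≤ L/2`: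
`|⟨F ∘ torusLift⟩^{W,per}_{(ℤ/(L+1))⁴, β_W} − ∫ F dμ| ≤ 2√2 · K · #Δ · max(ρ,½)^{⌊(n − m)/max(1,R)⌋₊}`. [folklore] -/
theorem su2_abs_periodised_sub_integral_le_dim4 {βW ε₀ ε₁ ρ R : ℝ}
    (hρ : 6 * |βW| * exp ε₀ + exp (ε₀ / 2) * Real.sqrt (2 / 3) * ε₁ ≤ ρ) (hρ1 : ρ < 1)
    {W : Potential (ZdEdge 4) (SUN 2)} {supp : Finset (ZdEdge 4) → Finset (Finset (ZdEdge 4))}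
    (hmem : MemBallZd ε₀ ε₁ R W supp) (hg : ∀ X, IsZdGaugeInvariant (W X))
    (hb : ∀ X, ∃ C, ∀ U, |W X U| ≤ C)
    {μ : Measure (LGConfig 4 (SUN 2))}
    (hμ : μ ∈ perturbedGibbsMeasures (d := 4) (fundamentalRep (Fin 2)) ((2 : ℕ) * (βW / 4)) W supp)
    {m n L : ℕ} (hmn : m ≤ n) (hL : (n : ℝ) + max 1 R ≤ (L / 2 : ℕ))
    {F : LGConfig 4 (SUN 2) → ℝ} {Δ : Finset (ZdEdge 4)} {K : ℝ≥0} (hF : IsLipschitzCylinder (fundamentalRep (Fin 2)) F Δ K)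
    (hΔ : Δ ⊆ boxLinks 4 m) :
    |(periodisedFamily W supp hmem.dependsOn hg (fun X => (hmem.continuous X).measurable) hb L).expectation
        (fundamentalRep (Fin 2)) ((2 : ℕ) * (βW / 4)) (toTorusObservable (L + 1) F) - ∫ U, F U ∂μ| ≤
      2 * Real.sqrt 2 * K * Δ.card * (max ρ (1 / 2)) ^ ⌊((n : ℝ) - m) / max 1 R⌋₊ := by
  haveI : SecondCountableTopology (Matrix (Fin 2) (Fin 2) ℂ) :=
    inferInstanceAs (SecondCountableTopology (Fin 2 → Fin 2 → ℂ))
  haveI : SecondCountableTopology (SUN 2) := Topology.IsEmbedding.subtypeVal.secondCountableTopology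
  obtain ⟨osc, lip, hosc, hlip, hosca, hΛ⟩ := hmem.loads
  have hW : W.IsAdapted := fun X => ⟨hmem.dependsOn X, (hmem.continuous X).measurable⟩
  have hc : (0 : ℝ) ≤ 2 / 3 := by norm_num
  have hP : ∀ B : Matrix (Fin 2) (Fin 2) ℂ, matrixOpNorm B ≤ |βW / 4| * (2 * (((4 : ℕ) : ℝ) - 1)) →
      ∀ (ψ : Matrix.specialUnitaryGroup (Fin 2) ℂ → ℝ) (M : ℝ), 0 ≤ M →
        (∀ x y, |ψ x - ψ y| ≤ M * suFrobDist x y) →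
        Var[ψ; (haarProbability (Matrix.specialUnitaryGroup (Fin 2) ℂ)).tilted
          fun g => ((2 : ℕ) : ℝ) * ((g : Matrix (Fin 2) (Fin 2) ℂ) * B).trace.re] ≤ 2 / 3 * M ^ 2 :=
    fun B hB ψ M hM hψ => oneLinkPoincareSUN_two_sharp _ B hB ψ M hM hψ
  have hVB := linVariance_of_poincare (N := 2) hP
  have hv : (0 : ℝ) ≤ 2 / 3 * ((2 : ℕ) : ℝ) ^ 2 := by norm_num
  have hKR := isKRContraction_perturbedYM_SU (d := 4) (by norm_num) (by norm_num) hc hv le_rfl hP hVB hW (supp := supp)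
    hosc hosca hlip
  have hsq : Real.sqrt (2 / 3 * (2 / 3 * ((2 : ℕ) : ℝ) ^ 2)) = 4 / 3 := by
    rw [show (2 / 3 * (2 / 3 * ((2 : ℕ) : ℝ) ^ 2) : ℝ) = (4 / 3) ^ 2 by norm_num, Real.sqrt_sq (by norm_num)]
  have hρ' : 6 * (((4 : ℕ) : ℝ) - 1) * |βW / 4| * (exp ε₀ * Real.sqrt (2 / 3 * (2 / 3 * ((2 : ℕ) : ℝ) ^ 2))) +
      exp (ε₀ / 2) * Real.sqrt (2 / 3) * ε₁ ≤ ρ := by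
    rw [hsq]
    have e : 6 * (((4 : ℕ) : ℝ) - 1) * |βW / 4| * (exp ε₀ * (4 / 3)) = 6 * |βW| * exp ε₀ := by
      rw [abs_div, abs_of_pos (by norm_num : (0 : ℝ) < 4)]
      norm_num
      ring
    rw [e]
    exact hρ
  have hrow : ∀ x, ∑ y ∈ perturbedNbr supp x,
      (exp ε₀ * Real.sqrt (2 / 3 * (2 / 3 * ((2 : ℕ) : ℝ) ^ 2)) * |βW / 4| * linkInfluence x y +
        exp (ε₀ / 2) * Real.sqrt (2 / 3) * ∑ X ∈ (supp {x}).filter (fun X => x ∈ X), lip X y) ≤ ρ :=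
    fun x => (sum_perturbedNbr_coeff_le (d := 4) (by norm_num) (β := βW / 4) (c := 2 / 3) (v := 2 / 3 * ((2 : ℕ) : ℝ) ^ 2)
      (a := ε₀) hΛ x).trans hρ'
  have h := abs_periodised_sub_integral_le_of_isKRContraction hmem.dependsOn hg (fun X => (hmem.continuous X).measurable) hb
    hmem.continuous hmem.supportedBy hKR hrow hρ1 hmem.range hμ hmn hL hF hΔ
  have e2 : Real.sqrt ((2 : ℕ) : ℝ) = Real.sqrt 2 := by norm_num
  rw [e2] at h
  exact h

end Summit.Ventures.YMGap.RobustBall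

end
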